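import Summits.BirchSwinnertonDyer.BirchSwinnertonDyer.Theorems.ErratumRoadFiveNonSurjCornerShape
import Literature.NumberTheory.EllipticCurves.NeronOggShafarevichLocal
import Literature.NumberTheory.EllipticCurves.LocalFrobeniusGenerationProofs
import HarnessLib

/-!
# Route `ErratumRoadFive` (rung K2), crux `NonSurjCorner` (item stmt-BirchSwinnertonDyer-19065):
# THE INERTIA FRAME AT `p` ON THE WHOLE CORNER — at every pair with `p` odd multiplicative and
# `p ∤ #ρ̄_{E,p}(Γ_ℚ)` (e.g. `E[p]` irreducible and `ρ̄_{E,p}` NOT onto), the decomposition group of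
# every prime above `p` acts on `E[p]` DIAGONALLY in the inertia frame, and `E[p]^{I_p}` is a line
# (cell `bsd-stepL`, seat `bsd-stepL-corner5-p2` g3, WIDTH-LEVER lane B «class-level road»;
# `--supports stmt-BirchSwinnertonDyer-19065 --as helper`; file 1 of 2, sequel `…LocalSplit`)

WHY THIS FILE. The lineage's shape theorems (g2: `ErratumRoadFiveNonSurjCornerShape{,Five}`,
`…ImageFull`) place the decomposition groups above `p` inside the index-2 «Cartan subgroup»
`U ≤ Γ_ℚ` — but only on the CARTAN sub-corner (`p ≥ 7`, or `p = 5` with `3 ∤ #G`), because `U` needs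
`G ≤ N(C)`. The LOCAL statement needs much less and holds on the WHOLE corner, octahedral `5S4`
included (and verbatim at `p = 3`): as soon as `p ∤ #ρ̄_{E,p}(Γ_ℚ)` (automatic for an irreducible
non-surjective image, Serre Prop. 15) and `p ≠ 2` is multiplicative, the image of the inertia group
`I_𝔏` of a prime `𝔏 ∣ p` of `ℤ̄` is a split half-Cartan subgroup `P (1 0; 0 *) P⁻¹` (x11c gen 7,
`GaloisImage.exists_halfSplitCartan_eq_inertia_image_of_mult`: Serre §1.12 with trivial Kummer class),
and an element of `GL₂(𝔽_p)` conjugating `P (1 0; 0 *) P⁻¹` into itself lies in `P (* 0; 0 *) P⁻¹`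
(g2's group lemma `CornerShape.mem_splitCartan_of_forall_conj_mem_halfSplitCartan`). Hence:

* §1 two transport lemmas (folklore): the decomposition group `D_𝔏 = Stab_{Γ_K}(𝔏)` normalises
  `I_𝔏` (`conj_mem_inertia_of_mem_stabilizer`); along a `K`-embedding `ι : K̄ → K̄_v` the WHOLE local
  Galois group `Γ_{K_v}` restricts into `D_{𝔓_{ι,𝔐}}` (`resGalOfEmb_mem_stabilizer_primeBelow`; the
  tree had the inertia half, `resGalOfEmb_mem_inertia_primeBelow`).
* §2 (framed) `exists_inertiaFrame{,_stabilizer}`: some `P` has `Φ(ρ̄(I_𝔏)) = P (1 0; 0 *) P⁻¹`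
  AND `Φ(ρ̄(D_𝔏)) ≤ P (* 0; 0 *) P⁻¹`. §2b `forall_inertia_smul_eq_iff`: the vectors fixed by `I_𝔏`
  are EXACTLY the line `e⁻¹(𝔽_p · P e₀)`. So `E[p]|_{D_𝔏} ≅ δ₁ ⊕ δ₂` with `δ₁` unramified and `δ₂`
  ramified (`δ₁ δ₂ = det = ω`): the local Galois module at `p` is SPLIT, for every corner pair.

The sequel `ErratumRoadFiveNonSurjCornerLocalSplit.lean` turns the two lines into cyclic subgroups of
`E[p]`, reads everything on `Γ_{ℚ_p}` along `res_ι`, and packages it frame-free at the crux hypotheses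
(`ClassX11b W p`, `¬ Surj W p`). HONEST FRAMING: structure theorems about the local Galois module
`E[p]|_{Γ_{ℚ_p}}` at a corner pair; nothing here proves the crux, a registered stub (`stub_corner5`,
`stub_corner7`) or BSD for any class; no census number moves. Which unramified character `δ₁` is
(the Tate-curve sign `χ_γ`, `δ₁(Frob_p) = a_p = ±1`) is NOT proved here.

References: [Serre1972] §1.11–§1.12 (inertia at a multiplicative `v ∣ p`: `(χ *; 0 1)`), §2.1 a),
§2.4 Prop. 15; [SilvermanATAEC1994] V.4–V.6, Ex. 5.13; [NeukirchANT1999] II (9.6);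
tree files `GaloisImage/MultiplicativeCartanNormalizer`, `Theorems/ErratumRoadFiveNonSurjCornerShape`,
`NeronOggShafarevichLocal`, `LocalFrobeniusGenerationProofs`.
-/

set_option linter.dupNamespace false -- `Summit.BirchSwinnertonDyer.BirchSwinnertonDyer` (summit = problem), tree-wide
set_option autoImplicit false

noncomputable section

open scoped Classical NumberField Pointwise
open IsDedekindDomain Field Matrix

/-! ### §1. Transport lemmas: decomposition groups normalise inertia; `Γ_{K_v}` restricts into `D_𝔏` -/

namespace Summit.BirchSwinnertonDyer.BirchSwinnertonDyer.Theorems.CornerLocal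

/-- **The decomposition group normalises the inertia group** (any group `M` acting on a ring `R`,
any ideal `P`): if `s • P = P` and `τ • x - x ∈ P` for all `x`, then `(s τ s⁻¹) • x - x =
s • (τ • (s⁻¹ • x) - s⁻¹ • x) ∈ s • P = P`. [folklore] -/
theorem conj_mem_inertia_of_mem_stabilizer {M R : Type*} [Group M] [Ring R] [MulSemiringAction M R]
    (P : Ideal R) {s τ : M} (hs : s ∈ MulAction.stabilizer M P) (hτ : τ ∈ P.inertia M) :
    s * τ * s⁻¹ ∈ P.inertia M := by
  intro x
  have h1 : (s * τ * s⁻¹) • x - x = s • (τ • (s⁻¹ • x) - s⁻¹ • x) := by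
    rw [smul_sub, ← mul_smul, ← mul_smul, smul_inv_smul, mul_assoc]
  rw [h1]
  have h2 := Ideal.smul_mem_pointwise_smul s _ P (hτ (s⁻¹ • x))
  rwa [MulAction.mem_stabilizer_iff.mp hs] at h2

end Summit.BirchSwinnertonDyer.BirchSwinnertonDyer.Theorems.CornerLocal

namespace IsDedekindDomain.HeightOneSpectrum

open Literature.NumberTheory.EllipticCurves Literature.NumberTheory.GaloisRepresentations Field

universe u

variable {K : Type u} [Field K] [NumberField K] (v : HeightOneSpectrum (𝓞 K))
  (ι : AlgebraicClosure K →ₐ[K] AlgebraicClosure (v.adicCompletion K))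

set_option synthInstance.maxHeartbeats 200000 in
/-- **The whole local Galois group restricts into the decomposition group.** For a `K`-embedding
`ι : K̄ → K̄_v`, a prime `𝔐` of the local absolute integers `\bar 𝓞_v` above `𝓂_v` and ANY
`σ ∈ Γ_{K_v}`, the restriction `res_ι σ ∈ Γ_K` stabilises the prime `𝔓_{ι,𝔐} = ι⁻¹(𝔐) ∩ \bar ℤ_K`:
`σ` fixes `𝔐` (the decomposition group of `𝔐` is all of `Γ_{K_v}`, `K_v` henselian —
`smul_eq_of_mem_localPrimesAbove`) and `ι (res_ι σ b) = σ (ι b)`. The formal inclusion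
`G(L_w|K_v) → G_w(L|K)` of Neukirch, *ANT*, II (9.6) (the tree had its inertia half,
`resGalOfEmb_mem_inertia_primeBelow`). [cite: NeukirchANT1999, Ch. II §9 Prop. (9.6)] -/
theorem resGalOfEmb_mem_stabilizer_primeBelow {𝔐 : Ideal (localAbsIntegers v)}
    (h𝔐 : 𝔐 ∈ v.localPrimesAbove) (σ : absoluteGaloisGroup (v.adicCompletion K)) :
    resGalOfEmb ι σ ∈ MulAction.stabilizer (absoluteGaloisGroup K) (v.primeBelow ι 𝔐) := by
  have key : ∀ (σ' : absoluteGaloisGroup (v.adicCompletion K)) (b : absIntegers (𝓞 K) K),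
      absIntegersToLocal v ι (resGalOfEmb ι σ' • b) = σ' • absIntegersToLocal v ι b := by
    intro σ' b
    apply Subtype.ext
    rw [coe_absIntegersToLocal_apply, integralClosure.coe_smul, integralClosure.coe_smul,
      coe_absIntegersToLocal_apply]
    exact apply_resGalAuxOfEmb_apply ι σ' b
  rw [MulAction.mem_stabilizer_iff]
  ext b
  rw [Ideal.mem_pointwise_smul_iff_inv_smul_mem, mem_primeBelow_iff, mem_primeBelow_iff, ← map_inv,
    key, ← Ideal.mem_pointwise_smul_iff_inv_smul_mem, smul_eq_of_mem_localPrimesAbove v h𝔐 σ]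

set_option synthInstance.maxHeartbeats 200000 in
/-- Along `ι`, every `σ ∈ Γ_{K_v}` restricts to an element of `Γ_K` NORMALISING the inertia group
`I_{𝔓_{ι,𝔐}}` (it lies in the decomposition group, which normalises inertia).
[cite: NeukirchANT1999, Ch. II §9 Prop. (9.6)] -/
theorem conj_resGalOfEmb_mem_inertia_primeBelow {𝔐 : Ideal (localAbsIntegers v)}
    (h𝔐 : 𝔐 ∈ v.localPrimesAbove) (σ : absoluteGaloisGroup (v.adicCompletion K))
    {τ : absoluteGaloisGroup K} (hτ : τ ∈ (v.primeBelow ι 𝔐).inertia (absoluteGaloisGroup K)) :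
    resGalOfEmb ι σ * τ * (resGalOfEmb ι σ)⁻¹ ∈ (v.primeBelow ι 𝔐).inertia (absoluteGaloisGroup K) :=
  Summit.BirchSwinnertonDyer.BirchSwinnertonDyer.Theorems.CornerLocal.conj_mem_inertia_of_mem_stabilizer
    _ (resGalOfEmb_mem_stabilizer_primeBelow v ι h𝔐 σ) hτ

end IsDedekindDomain.HeightOneSpectrum

namespace Summit.BirchSwinnertonDyer.BirchSwinnertonDyer.Theorems.CornerLocal

open WeierstrassCurve NumberField Rat.HeightOneSpectrum
  Literature.NumberTheory.EllipticCurves Literature.NumberTheory.GaloisRepresentations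
  Literature.NumberTheory.GaloisRepresentations.Serre1972
  Literature.NumberTheory.EllipticCurves.Rank1Residual
  Summit.BirchSwinnertonDyer.Rank1Residual Summit.BirchSwinnertonDyer.Rank1Residual.GaloisImage
  Summit.BirchSwinnertonDyer.BirchSwinnertonDyer.Theorems.CornerShape

variable (W : WeierstrassCurve ℚ) [W.IsElliptic] (p : ℕ) [hp : Fact p.Prime]

section Frame

variable (Φ : Multiplicative (AddAut (geomTorsion W p)) ≃* GL (Fin 2) (ZMod p))
  (e : geomTorsion W p ≃+ (Fin 2 → ZMod p))
  (he : ∀ (g : Multiplicative (AddAut (geomTorsion W p))) (x : geomTorsion W p),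
    e (Multiplicative.toAdd g x) =
      ((Φ g : GL (Fin 2) (ZMod p)) : Matrix (Fin 2) (Fin 2) (ZMod p)) *ᵥ e x)

include he

/-! ### §2. The inertia frame: `Φ(ρ̄(I_𝔏)) = P (1 0; 0 *) P⁻¹`, `Φ(ρ̄(D_𝔏)) ≤ P (* 0; 0 *) P⁻¹` -/

/-- **THE INERTIA FRAME (whole corner).** For `W/ℚ` elliptic, `p ≠ 2` multiplicative,
`p ∤ #G` (`G = Φ(ρ̄_{E,p}(Γ_ℚ))`; automatic when `E[p]` is irreducible and `ρ̄` is not onto), `v` the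
place of `p` and `𝔏 ∣ v` a prime of `ℤ̄`: some `P ∈ GL₂(𝔽_p)` has
(1) `Φ(ρ̄(I_𝔏)) = P (1 0; 0 *) P⁻¹` EXACTLY (x11c gen 7: Serre §1.12, the Kummer cocycle of the Tate
parameter is trivial because `p ∤ #G`, and the cyclotomic character is onto on inertia), and
(2) every `g ∈ Γ_ℚ` normalising `I_𝔏` — in particular the whole decomposition group `D_𝔏` — maps into
the split Cartan subgroup `P (* 0; 0 *) P⁻¹` (`mem_splitCartan_of_forall_conj_mem_halfSplitCartan`).
No hypothesis `G ≤ N(C)`: the octahedral `5S4` sub-corner and `p = 3` are included.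
[cite: Serre1972, §1.12 and §2.1 a)] -/
theorem exists_inertiaFrame (hp2 : p ≠ 2) (hmult : Mult W p)
    (hG : ¬ p ∣ Nat.card ((galoisRepTorsion W p).range.map Φ.toMonoidHom))
    {v : HeightOneSpectrum (𝓞 ℚ)} (hv : (primesEquiv v : ℕ) = p)
    {𝔏 : Ideal (absIntegers (𝓞 ℚ) ℚ)} (h𝔏 : 𝔏 ∈ v.primesAbove) :
    ∃ P : GL (Fin 2) (ZMod p),
      ((𝔏.inertia (absoluteGaloisGroup ℚ)).map (galoisRepTorsion W p)).map Φ.toMonoidHom =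
        halfSplitCartan P ∧
      ∀ g : absoluteGaloisGroup ℚ,
        (∀ τ ∈ 𝔏.inertia (absoluteGaloisGroup ℚ),
          g * τ * g⁻¹ ∈ 𝔏.inertia (absoluteGaloisGroup ℚ)) →
        Φ (galoisRepTorsion W p g) ∈ splitCartan P := by
  obtain ⟨u, hu⟩ := exists_units_ne_one hp2
  set ρ := galoisRepTorsion W p with hρ
  obtain ⟨P, hP⟩ :=
    GaloisImage.exists_halfSplitCartan_eq_inertia_image_of_mult W p Φ e he hp2 hmult hG hv h𝔏
  refine ⟨P, hP, fun g hg ↦ ?_⟩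
  have hnorm : ∀ h ∈ halfSplitCartan P, Φ (ρ g) * h * (Φ (ρ g))⁻¹ ∈ halfSplitCartan P := by
    intro h hh
    rw [← hP] at hh ⊢
    obtain ⟨x, ⟨τ, hτ, rfl⟩, rfl⟩ := hh
    refine ⟨ρ (g * τ * g⁻¹), ⟨g * τ * g⁻¹, hg τ hτ, rfl⟩, ?_⟩
    simp only [MulEquiv.coe_toMonoidHom, map_mul, map_inv, hρ]
  exact mem_splitCartan_of_forall_conj_mem_halfSplitCartan hu hnorm

/-- **The decomposition group acts diagonally in the inertia frame**: with `P` as in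
`exists_inertiaFrame`, `Φ(ρ̄(g)) ∈ P (* 0; 0 *) P⁻¹` for every `g` in the decomposition group
`D_𝔏 = Stab_{Γ_ℚ}(𝔏)` (which normalises `I_𝔏`, §1). [cite: Serre1972, §1.12 and §2.1 a)] -/
theorem exists_inertiaFrame_stabilizer (hp2 : p ≠ 2) (hmult : Mult W p)
    (hG : ¬ p ∣ Nat.card ((galoisRepTorsion W p).range.map Φ.toMonoidHom))
    {v : HeightOneSpectrum (𝓞 ℚ)} (hv : (primesEquiv v : ℕ) = p)
    {𝔏 : Ideal (absIntegers (𝓞 ℚ) ℚ)} (h𝔏 : 𝔏 ∈ v.primesAbove) :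
    ∃ P : GL (Fin 2) (ZMod p),
      ((𝔏.inertia (absoluteGaloisGroup ℚ)).map (galoisRepTorsion W p)).map Φ.toMonoidHom =
        halfSplitCartan P ∧
      ∀ g ∈ MulAction.stabilizer (absoluteGaloisGroup ℚ) 𝔏,
        g ∈ ((splitCartan P).comap Φ.toMonoidHom).comap (galoisRepTorsion W p) := by
  obtain ⟨P, hP, hnorm⟩ := exists_inertiaFrame W p Φ e he hp2 hmult hG hv h𝔏
  exact ⟨P, hP, fun g hg ↦ (mem_comap_cartan_iff W p Φ).mpr
    (hnorm g fun τ hτ ↦ conj_mem_inertia_of_mem_stabilizer 𝔏 hg hτ)⟩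

/-! ### §2b. In the inertia frame: `E[p]^{I_𝔏}` is the line `P e₀`; inertia is onto `𝔽_pˣ` on `P e₁` -/

omit [W.IsElliptic] in
/-- **The inertia-fixed vectors are exactly the first line of the inertia frame.** If
`Φ(ρ̄(I_𝔏)) = P (1 0; 0 *) P⁻¹` then `x ∈ E[p]` is fixed by every `τ ∈ I_𝔏` iff `e x ∈ 𝔽_p · P e₀`:
`E[p]^{I_𝔏}` is a LINE (neither `0` — contrast x11c's `E[p]^{I_p} = 0` in the très ramifié case
`p ∤ ord_p Δ_min` — nor everything). (`⇐`: `diag(1,u)` fixes `e₀`; `⇒`: `diag(1,u)` with `u ≠ 1`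
(`p ≠ 2`) is some `Φ(ρ̄ τ)`, `τ ∈ I_𝔏`, and fixes `P⁻¹ e x` only if its second coordinate vanishes.)
[cite: Serre1972, §1.12 and §2.1 a)] -/
theorem forall_inertia_smul_eq_iff (hp2 : p ≠ 2) {P : GL (Fin 2) (ZMod p)}
    {I : Subgroup (absoluteGaloisGroup ℚ)}
    (hP : (I.map (galoisRepTorsion W p)).map Φ.toMonoidHom = halfSplitCartan P)
    (x : geomTorsion W p) :
    (∀ τ ∈ I, τ • x = x) ↔
      ∃ a : ZMod p, e x = a • (P : Matrix (Fin 2) (Fin 2) (ZMod p)).col 0 := by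
  set ρ := galoisRepTorsion W p with hρ
  -- coordinates in the frame `P`: `y = P⁻¹ (e x)`, `e x = P y`
  set y : Fin 2 → ZMod p := ((P⁻¹ : GL (Fin 2) (ZMod p)) : Matrix (Fin 2) (Fin 2) (ZMod p)) *ᵥ e x
    with hy
  have hexy : e x = ((P : GL (Fin 2) (ZMod p)) : Matrix (Fin 2) (Fin 2) (ZMod p)) *ᵥ y := by
    rw [hy, Matrix.mulVec_mulVec, ← Units.val_mul, mul_inv_cancel, Units.val_one, Matrix.one_mulVec]
  -- how an element `Φ(ρ τ) = P D P⁻¹`, `D = diag(1, d)`, acts: `e (τ • x) = P (D y)`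
  have hact : ∀ τ : absoluteGaloisGroup ℚ, Φ (ρ τ) ∈ halfSplitCartan P →
      ∃ d : ZMod p, e (τ • x) =
        ((P : GL (Fin 2) (ZMod p)) : Matrix (Fin 2) (Fin 2) (ZMod p)) *ᵥ ![y 0, d * y 1] := by
    intro τ hmem
    obtain ⟨⟨h01, h10⟩, h00⟩ := mem_halfSplitCartan_iff.mp hmem
    set D : GL (Fin 2) (ZMod p) := P⁻¹ * Φ (ρ τ) * P with hD
    have hgD : Φ (ρ τ) = P * D * P⁻¹ := by rw [hD]; group
    refine ⟨((D : GL (Fin 2) (ZMod p)) : Matrix (Fin 2) (Fin 2) (ZMod p)) 1 1, ?_⟩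
    have hDy : ((D : GL (Fin 2) (ZMod p)) : Matrix (Fin 2) (Fin 2) (ZMod p)) *ᵥ y =
        ![y 0, ((D : GL (Fin 2) (ZMod p)) : Matrix (Fin 2) (Fin 2) (ZMod p)) 1 1 * y 1] := by
      ext i
      fin_cases i <;>
        simp [Matrix.mulVec, dotProduct, Fin.sum_univ_two, h00, h10, h01]
    have h1 : τ • x = Multiplicative.toAdd (ρ τ) x := rfl
    rw [h1, he, hexy, hgD, Units.val_mul, Units.val_mul, ← Matrix.mulVec_mulVec,
      ← Matrix.mulVec_mulVec, Matrix.mulVec_mulVec _ (((P⁻¹ : GL (Fin 2) (ZMod p)) :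
        Matrix (Fin 2) (Fin 2) (ZMod p))), ← Units.val_mul, inv_mul_cancel, Units.val_one,
      Matrix.one_mulVec, hDy]
  have hPinj : Function.Injective fun z : Fin 2 → ZMod p ↦
      ((P : GL (Fin 2) (ZMod p)) : Matrix (Fin 2) (Fin 2) (ZMod p)) *ᵥ z := by
    intro z₁ z₂ h
    have := congrArg (fun w ↦ ((P⁻¹ : GL (Fin 2) (ZMod p)) : Matrix (Fin 2) (Fin 2) (ZMod p)) *ᵥ w) h
    simpa only [Matrix.mulVec_mulVec, ← Units.val_mul, inv_mul_cancel, Units.val_one,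
      Matrix.one_mulVec] using this
  constructor
  · -- `⇒`: use `diag(1, u)`, `u ≠ 1`, which is `Φ(ρ τ)` for some `τ ∈ I`
    intro hfix
    obtain ⟨u, hu⟩ := exists_units_ne_one hp2
    have hmem : (MulAut.conj P).toMonoidHom (halfDiagonalHom u) ∈ halfSplitCartan P :=
      ⟨halfDiagonalHom u, by rw [← range_halfDiagonalHom]; exact ⟨u, rfl⟩, rfl⟩
    rw [← hP] at hmem
    obtain ⟨g, ⟨τ, hτ, rfl⟩, hgτ⟩ := hmem
    have hmem' : Φ (ρ τ) ∈ halfSplitCartan P := by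
      rw [← hP]; exact ⟨ρ τ, ⟨τ, hτ, rfl⟩, rfl⟩
    -- `D = diag(1,u)` here: compute the `1 1` entry
    have hD11 : (((P⁻¹ * Φ (ρ τ) * P : GL (Fin 2) (ZMod p)) : GL (Fin 2) (ZMod p)) :
        Matrix (Fin 2) (Fin 2) (ZMod p)) 1 1 = u := by
      have hconj : P⁻¹ * Φ (ρ τ) * P = halfDiagonalHom u := by
        have : Φ.toMonoidHom (ρ τ) = (MulAut.conj P).toMonoidHom (halfDiagonalHom u) := hgτ
        rw [MulEquiv.coe_toMonoidHom, MulEquiv.coe_toMonoidHom, MulAut.conj_apply] at this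
        rw [show Φ (ρ τ) = P * halfDiagonalHom u * P⁻¹ from this]; group
      rw [hconj, coe_halfDiagonalHom]
      simp [Matrix.diagonal]
    obtain ⟨⟨h01, h10⟩, h00⟩ := mem_halfSplitCartan_iff.mp hmem'
    have h1 : τ • x = Multiplicative.toAdd (ρ τ) x := rfl
    have hfx := hfix τ hτ
    rw [← e.injective.eq_iff, h1, he, hexy] at hfx
    set D : GL (Fin 2) (ZMod p) := P⁻¹ * Φ (ρ τ) * P with hD
    have hgD : Φ (ρ τ) = P * D * P⁻¹ := by rw [hD]; group
    rw [hgD, Units.val_mul, Units.val_mul, ← Matrix.mulVec_mulVec, ← Matrix.mulVec_mulVec,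
      Matrix.mulVec_mulVec _ (((P⁻¹ : GL (Fin 2) (ZMod p)) : Matrix (Fin 2) (Fin 2) (ZMod p))),
      ← Units.val_mul, inv_mul_cancel, Units.val_one, Matrix.one_mulVec] at hfx
    have hDy := hPinj hfx
    have hy1 : y 1 = 0 := by
      have h := congrFun hDy 1
      simp only [Matrix.mulVec, dotProduct, Fin.sum_univ_two, h10, zero_mul, zero_add] at h
      rw [hD11] at h
      -- `u * y 1 = y 1`
      have hu1 : (u : ZMod p) ≠ 1 := fun h' ↦ hu (Units.ext h')
      have : ((u : ZMod p) - 1) * y 1 = 0 := by rw [sub_mul, one_mul, h, sub_self]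
      rcases mul_eq_zero.mp this with h' | h'
      · exact absurd (sub_eq_zero.mp h') hu1
      · exact h'
    refine ⟨y 0, ?_⟩
    rw [hexy]
    ext i
    fin_cases i <;> simp [Matrix.mulVec, dotProduct, Fin.sum_univ_two, Matrix.col_apply, hy1, mul_comm]
  · -- `⇐`: `diag(1, d)` fixes `P e₀`
    rintro ⟨a, ha⟩ τ hτ
    have hmem : Φ (ρ τ) ∈ halfSplitCartan P := by
      rw [← hP]; exact ⟨ρ τ, ⟨τ, hτ, rfl⟩, rfl⟩
    have hya : y = ![a, 0] := by
      apply hPinj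
      simp only
      rw [← hexy, ha]
      ext i
      fin_cases i <;> simp [Matrix.mulVec, dotProduct, Fin.sum_univ_two, Matrix.col_apply, mul_comm]
    obtain ⟨d, hd⟩ := hact τ hmem
    apply e.injective
    rw [hd, hexy, hya]
    congr 1
    ext i
    fin_cases i <;> simp

end Frame

end Summit.BirchSwinnertonDyer.BirchSwinnertonDyer.Theorems.CornerLocal

end
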